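import Summits.CriticalPhenomena.PercolationContinuityZ3.Theorems.Transplant.BccSlabStackedA
import Summits.CriticalPhenomena.PercolationContinuityZ3.Theorems.Transplant.BccSlabColRouting
import HarnessLib

/-!
# The bcc (001)-slabs, exit-form routing certificate XI: STACKED ROUTING (both height orders, via the height flip of the slab) and
# **`θ_{S_k(bcc)}(v, p_c(S_k(bcc))) = 0` for every `k ≥ 3` — UNCONDITIONAL, p205010-free**

builds on p205010 (kernel theorem, internal audit signed; external expert review pending) — NOT used in this file.
Lane `prim-bschramm`, seat `prim-bschramm-p2` (gen 46; class C1b, METHOD = input substitution; memo `HOME/bschramm/P2-LATTICES.md` §156); helper file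
(`--supports stmt-CriticalPhenomena-4575 --as helper`).
* §1 **the height flip** `BccSlab.flipIso k : S_k(bcc) ≃ S_k(bcc)`, `x ↦ (x₀ + e, x₁ + e, k − x₂)` with `e = k mod 2` (a point-group element followed by a
  bcc translation; it shifts the shadow by `(e, 0)` and reverses heights);
* §2 **`Frame.stacked_up`**: the stacked templates «BccSlabStackedB» (`Δ = 2`) and «BccSlabStackedA» (`Δ ≥ 4`) assembled for `E₁` BELOW `E₂`;
* §3 **`BccSlab.stackedRouting`** (`k ≥ 3`): `E₁` above `E₂` is reduced to §2 through the flip («HexShadowVRouteData».`VRouteData.map`), hence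
  «BccSlabColRouting».`StackedRouting k`; and the ROW: **`BccSlab.theta_criticalProb_eq_zero`** — for every `k ≥ 3` and every vertex `v` of the bcc
  (001)-slab `S_k(bcc)`, `θ(v, p_c(S_k(bcc))) = 0` (Duminil-Copin–Sidoravicius–Tassion transplanted through the square shadow; `k = 1` is
  «BccSlabSqShadowCritical».`theta_criticalProb_eq_zero_one`; `k = 2` open here).
[cite: DuminilCopinSidoraviciusTassion2016, Thm. 1 and §2.3] [cite: BenjaminiSchramm1996, Conj. 4 / Question 3] [cite: ConwaySloane1999, Ch. 4 §7.1]
-/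

noncomputable section

namespace Summit.CriticalPhenomena.PercolationContinuityZ3.Theorems.Transplant

namespace BccSlab

open Literature.Probability.Percolation Literature.Probability.LatticeModels SimpleGraph BccClawX
open scoped Classical

variable {k : ℕ}

/-! ## §1 The height flip of the slab -/

/-- The bcc translation vector `(e, e, k)`, `e = k mod 2`, of the flip. [folklore] -/
def flipVec (k : ℕ) : bccSubgroup :=
  ⟨![(k : ℤ) % 2, (k : ℤ) % 2, k], by
    rcases Int.even_or_odd (k : ℤ) with he | ho
    · left; intro i
      have h0 : (k : ℤ) % 2 = 0 := Int.even_iff.1 he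
      fin_cases i <;> simp [h0, he]
    · right; intro i
      have h1 : (k : ℤ) % 2 = 1 := Int.odd_iff.1 ho
      fin_cases i <;> simp [h1, ho]⟩

/-- The signs `(+, +, −)` of the flip. [folklore] -/
def flipSigns : Fin 3 → ℤˣ := ![1, 1, -1]

/-- The ambient flip `x ↦ (x₀ + e, x₁ + e, k − x₂)` as an automorphism of the bcc graph. [cite: ConwaySloane1999, Ch. 4 §7.1] -/
def flipBcc (k : ℕ) : bccGraph ≃g bccGraph := (bccPointIso (Equiv.refl _) flipSigns).trans (bccShift (flipVec k))

/-- Coordinates of the ambient flip. [folklore] -/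
theorem flipBcc_apply (k : ℕ) (x : bccSite) :
    ((flipBcc k x : bccSite) : Site 3) 0 = (x : Site 3) 0 + (k : ℤ) % 2 ∧ ((flipBcc k x : bccSite) : Site 3) 1 = (x : Site 3) 1 + (k : ℤ) % 2 ∧
      ((flipBcc k x : bccSite) : Site 3) 2 = k - (x : Site 3) 2 := by
  refine ⟨?_, ?_, ?_⟩
  · simp [flipBcc, coe_bccShift, coe_bccPointIso, Site.signedPerm_apply, flipSigns, flipVec]
  · simp [flipBcc, coe_bccShift, coe_bccPointIso, Site.signedPerm_apply, flipSigns, flipVec]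
  · simp [flipBcc, coe_bccShift, coe_bccPointIso, Site.signedPerm_apply, flipSigns, flipVec]; ring

/-- **The height flip of the slab** `S_k(bcc)`. [cite: ConwaySloane1999, Ch. 4 §7.1] -/
def flipIso (k : ℕ) : slabGraph k ≃g slabGraph k :=
  isoInduceTo (flipBcc k) (bslab k) (bslab k) fun v => by
    obtain ⟨-, -, h2⟩ := flipBcc_apply k v
    rw [mem_bslab, mem_bslab, h2]; omega

/-- The flip reverses heights. [folklore] -/
theorem ht_flipIso (k : ℕ) (x : bslab k) : ht (flipIso k x) = k - ht x := by
  show (((flipIso k x : bslab k) : bccSite) : Site 3) 2 = k - ((x : bccSite) : Site 3) 2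
  rw [flipIso, isoInduceTo_apply_coe]; exact (flipBcc_apply k x).2.2

/-- The shadow shift of the flip: `(e, 0)`. [folklore] -/
def flipShift (k : ℕ) : Site 2 := ![(k : ℤ) % 2, 0]

/-- The flip shifts the shadow by `(e, 0)`. [folklore] -/
theorem sh_flipIso (k : ℕ) (x : bslab k) : sh (flipIso k x) = sh x + flipShift k := by
  obtain ⟨h0, h1, -⟩ := flipBcc_apply k x
  have a0 := two_mul_bccSkel_zero ((flipIso k x : bslab k) : bccSite)
  have a1 := two_mul_bccSkel_one ((flipIso k x : bslab k) : bccSite)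
  have b0 := two_mul_bccSkel_zero (x : bccSite)
  have b1 := two_mul_bccSkel_one (x : bccSite)
  have e : (((flipIso k x : bslab k) : bccSite) : Site 3) = ((flipBcc k x : bccSite) : Site 3) := rfl
  rw [e] at a0 a1
  rw [h0, h1] at a0 a1
  ext i; fin_cases i
  · show sh (flipIso k x) 0 = sh x 0 + (k : ℤ) % 2
    simp only [sh_eq] at *; omega
  · show sh (flipIso k x) 1 = sh x 1 + 0
    simp only [sh_eq] at *; omega

/-- The inverse flip shifts the shadow back. [folklore] -/
theorem sh_flipIso_symm (k : ℕ) (x : bslab k) : sh ((flipIso k).symm x) = sh x - flipShift k := by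
  have := sh_flipIso k ((flipIso k).symm x)
  rw [RelIso.apply_symm_apply] at this
  rw [this]; abel

/-! ## §2 The stacked templates assembled, `E₁` below `E₂` -/

/-- Frame columns translate. [folklore] -/
theorem fcol_add (A t : Site 2) (μ ν : Pt) (i j : ℤ) : fcol (A + t) μ ν i j = fcol A μ ν i j + t := by
  ext l; fin_cases l <;> simp [fcol] <;> ring

/-- A frame translates. [folklore] -/
theorem frame_add {RP : Set (Site 2)} {A : Site 2} {μ ν : Pt} (F : Frame RP A μ ν) (t : Site 2) :
    Frame {w | w - t ∈ RP} (A + t) μ ν :=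
  ⟨F.hμ, F.hν, F.hperp, fun i j a b c d => by rw [Set.mem_setOf_eq, fcol_add, add_sub_cancel_right]; exact F.hreg i j a b c d⟩

/-- **The stacked template, `E₁` below `E₂`** (any frame, any `k ≥ 3`). [cite: DuminilCopinSidoraviciusTassion2016, §2.3 (proof of Fact 2)] -/
theorem stacked_up (hk : 3 ≤ k) {RP : Set (Site 2)} {A : Site 2} {μ ν : Pt} (F : Frame RP A μ ν) {WR W : Set (bslab k)}
    (hWR : ∀ x : bslab k, sh x ∈ RP → x ∈ WR) (hWRW : WR ⊆ W) {E₁ E₂ w' : bslab k} (h1 : sh E₁ = A) (h2 : sh E₂ = A) (hlt : ht E₁ < ht E₂)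
    (hw : sh w' = fcol A μ ν 1 0) : ∃ r₁ r₂ : VRouteData (slabGraph k) WR W E₁ E₂ w', r₁.y = r₂.b ∧ r₁.b = r₂.y := by
  have hA : Adm k A (ht E₁) := h1 ▸ adm_sh_ht E₁
  have hA₂ : Adm k A (ht E₂) := h2 ▸ adm_sh_ht E₂
  have hS : Adm k (fcol A μ ν 1 0) (ht w') := hw ▸ adm_sh_ht w'
  have eE₁ : E₁ = fv k A μ ν 0 0 (ht E₁) := by rw [fv, fcol_zero, ← h1, vtx_sh_ht]
  have eE₂ : E₂ = fv k A μ ν 0 0 (ht E₂) := by rw [fv, fcol_zero, ← h2, vtx_sh_ht]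
  have ew : w' = fv k A μ ν 1 0 (ht w') := by rw [fv, ← hw, vtx_sh_ht]
  have hpar : Even (ht E₂ - ht E₁) := by
    obtain ⟨m, hm⟩ := hA.2.2; obtain ⟨m', hm'⟩ := hA₂.2.2; exact ⟨m - m', by omega⟩
  obtain ⟨m, hm⟩ := hpar
  rw [eE₁, eE₂, ew]
  by_cases h4 : ht E₁ + 4 ≤ ht E₂
  · exact F.stacked_swapPair_ge4 hWR hWRW hA hA₂ h4 hS
  · have h2' : ht E₂ = ht E₁ + 2 := by omega
    rw [h2']
    exact F.stacked_swapPair_two hk hWR hWRW hA (by rw [← h2']; exact hA₂.2.1) hS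

/-! ## §3 Stacked routing, and the slabs at their own critical point -/

/-- **STACKED ROUTING HOLDS for every `k ≥ 3`**: `E₁` below `E₂` is §2; `E₁` above `E₂` is §2 in the flipped slab, carried back by the flip.
[cite: DuminilCopinSidoraviciusTassion2016, §2.3 (proof of Fact 2)] -/
theorem stackedRouting (hk : 3 ≤ k) : StackedRouting k := by
  intro z tR tD sR sD E₁ E₂ w' μ ν hne h12 hF hw
  set RP : Set (Site 2) := Dcols z tD sD ∩ sqBlkR 3 z tR sR with hRP
  set WR : Set (bslab k) := clearedSet k z tD sD ∩ (sqShadow k).lift (sqBlkR 3 z tR sR) with hWRdef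
  have hWR : ∀ x : bslab k, sh x ∈ RP → x ∈ WR := fun x hx => ⟨hx.1, by rw [SqShadow.mem_lift, sqShadow_sh]; exact hx.2⟩
  have hWRW : WR ⊆ clearedSet k z tD sD := fun x hx => hx.1
  have hne' : ht E₁ ≠ ht E₂ := fun h => hne (by rw [← vtx_sh_ht E₁, ← vtx_sh_ht E₂, h12, h])
  rcases lt_or_gt_of_ne hne' with hlt | hgt
  · exact stacked_up hk hF hWR hWRW rfl h12.symm hlt hw
  · -- flip
    set α := flipIso k with hα
    set t := flipShift k with ht'
    have hF' := frame_add hF t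
    have hWR' : ∀ x : bslab k, sh x ∈ {w | w - t ∈ RP} → x ∈ {x | α.symm x ∈ WR} := by
      intro x hx; exact hWR _ (by rw [sh_flipIso_symm]; exact hx)
    have hWRW' : {x : bslab k | α.symm x ∈ WR} ⊆ {x | α.symm x ∈ clearedSet k z tD sD} := fun x hx => hWRW hx
    have hlt : ht (α E₁) < ht (α E₂) := by rw [ht_flipIso, ht_flipIso]; omega
    obtain ⟨r₁, r₂, hy, hb⟩ := stacked_up hk hF' hWR' hWRW' (E₁ := α E₁) (E₂ := α E₂) (w' := α w')
      (by rw [sh_flipIso]) (by rw [sh_flipIso, h12]) hlt (by rw [sh_flipIso, hw, fcol_add])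
    have e1 : α.symm (α E₁) = E₁ := RelIso.symm_apply_apply α E₁
    have e2 : α.symm (α E₂) = E₂ := RelIso.symm_apply_apply α E₂
    have e3 : α.symm (α w') = w' := RelIso.symm_apply_apply α w'
    rw [← e1, ← e2, ← e3]
    exact ⟨r₁.map α.symm (fun v hv => hv) (fun v hv => hv), r₂.map α.symm (fun v hv => hv) (fun v hv => hv),
      by rw [VRouteData.map_y, VRouteData.map_b, hy], by rw [VRouteData.map_y, VRouteData.map_b, hb]⟩

/-- **THE bcc (001)-SLABS AT THEIR OWN CRITICAL POINT: `θ_{S_k(bcc)}(v, p_c(S_k(bcc))) = 0` for every `k ≥ 3` and every vertex `v`** — UNCONDITIONAL and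
p205010-free: Duminil-Copin–Sidoravicius–Tassion's slab argument transplanted through the square shadow of the bcc slab («SqShadow*»,
«BccSlabSqShadow*»), with the exit-form routing certificate discharged by the cleared set `lift (block ∖ corners)`, the kernel-checked planar claw
table, the hub template and the stacked template.  (Thickness `k = 1`: «BccSlabSqShadowCritical».`theta_criticalProb_eq_zero_one`; `k = 2` is not covered
here.) [cite: DuminilCopinSidoraviciusTassion2016, Thm. 1 and §2] [cite: BenjaminiSchramm1996, Conj. 4 / Question 3] [cite: ConwaySloane1999, Ch. 4 §7.1] -/
theorem theta_criticalProb_eq_zero (hk : 3 ≤ k) (v : bslab k) : theta (slabGraph k) v (criticalProbIOf (slabGraph k) v) = 0 :=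
  theta_criticalProb_eq_zero_of_stackedRouting hk (stackedRouting hk) v

/-- **The same as the vanishing of the percolation probability at every vertex, packaged over all `k ≥ 3`.** [cite: DuminilCopinSidoraviciusTassion2016, Thm. 1] -/
theorem theta_criticalProb_eq_zero_all : ∀ k : ℕ, 3 ≤ k → ∀ v : bslab k, theta (slabGraph k) v (criticalProbIOf (slabGraph k) v) = 0 :=
  fun _ hk v => theta_criticalProb_eq_zero hk v

end BccSlab

end Summit.CriticalPhenomena.PercolationContinuityZ3.Theorems.Transplant

end
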